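/-
Copyright (c) 2026 the pub-hodgecm-mathlib formalisation cell (harness21).  Prover seat hodgecm-mathlib-K2E1-p08 (g5), Track B ∕ K2-LIT, h413 =
`stmt-HodgeConjecture-24833`, campaign «EIS-RANK-ONE» rung R4 «EIS-R4-growth», road (A), file (A3) part 1∕3; DEAL BY NAME of the dealer K2E1-plan (g3) 2026-09-04T05:32:09Z
([D3]; spec of record K2E4-p11 (g3) 05:27:07Z §1 «quantitative E4»).
-/
import Summits.HodgeConjecture.HodgeConjecture.Theorems.K2E1BorelEisensteinGodementCMThree   -- ★ R2 chain: (G) smear∕`borelHeight_mul_of_adelicVal_mem`, (G2) `coveringSum_kAverage`∕`borelHeight_coe_smul_of_borelRat`, (G3) `parabolicIntegral_borel_three_eq`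
import HarnessLib

/-!
# K2·E1 — `K2E1SiegelIntegralExplicit` (rung R4 «moderate growth», road (A), file (A3) part 1∕3): THE QUANTITATIVE SIEGEL-DOMAIN INTEGRAL E4 —
# `∫⁻_{G(𝔸)} 𝟙{H ≤ C₀} H^τ β' dμ = C' · ∫⁻_{B(𝔸)} 𝟙{H ≤ C₀} H^τ w₁ dμ_B = K' · C₀^{τ−2}` for EVERY `Γ'`-covering weight `β'`

Track B ∕ K2-LIT, crux h413 = `stmt-HodgeConjecture-24833`, route of record `HCCMUnconditional`; cell `hodgecm-mathlib`, squad K2, ENGINE E1, campaign EIS-RANK-ONE rung R4,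
road (A) «Godement's count» (dealer K2E1-plan (g3) 05:32:09Z [D3]; spec K2E4-p11 (g3) 05:27:07Z).  Prover seat `hodgecm-mathlib-K2E1-p08` (g5).  THEOREMS ONLY (no `def`, no
`instance`, no notation, no named-fact hypothesis, no `sorry`); lane `--kind proof --supports stmt-HodgeConjecture-24833 --as helper` (count-neutral, closes no socket).

WHY.  Godement's count ★ (G0) `K2E1GodementCount.summable_toReal_of_lintegral_weight_ne_top` bounds `Σ'_q H(γ̃_q g)^τ` by `(A^τ·m_g ∕ μC)·∫⁻ 𝟙{H ≤ A·C₀(g)} H^τ β' dμ`; the moderate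
growth file (A3) `K2E1BorelEisensteinModerateGrowth` needs the VALUE of that integral as a function of the cut-off, not only its finiteness (★ (G2) `siegelIntegral_ne_top_of_parabolicIntegral`).
* §1 (any `N`) **`exists_siegelIntegral_eq_mul_parabolicIntegral`** — ONE constant `C' = C·μ_K(K_U) ∈ (0,∞)` with `∫⁻_G 𝟙{H ≤ C₀} H^τ β' dμ = C'·∫⁻_B 𝟙{H ≤ C₀} H^τ w₁ dμ_B` for EVERY
  exponent `τ`, EVERY `Γ'`-weight `β'` and every `C₀`: the chain of ★ (G2) read as the equality it is — `∫⁻_G = C ∫⁻_B ∫⁻_{K_U}` (★ `exists_lintegral_eq_mul_lintegral_borel_lintegral_maximalCompact`),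
  `H(b k) = H(b)` on `K_U` (★ `borelHeight_mul_of_adelicVal_mem`), the `K_U`-average of `β'` is a `B(F)_B`-weight of mass `μ_K(K_U)` (★ `coveringSum_kAverage`), weight independence
  (★ `lintegral_mul_eq_of_coveringSum_eq`).
* §2 (`N = 3`) **`exists_siegelIntegral_eq_mul_rpow_three`** — with ★ (G3) `parabolicIntegral_borel_three_eq` (`[E:F] = 2`, `c² = 1 ≠ c`, `τ > 2`): `= K'·C₀^{τ−2}`, `K' = C'·K ∈ (0, ∞)`.
[Godement1964 §8; MoeglinWaldspurger1995 II.1.5; Garrett2018 §3.10.]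

HONEST LABEL: HC_CM is proved only modulo the 7 printed citations (2 remaining named inputs: hLiu418 = `stmt-HodgeConjecture-24832`, h413 = `stmt-HodgeConjecture-24833`) until
rung 0 closes; count-neutral helper, closes no socket.

## References
* [Godement1964] R. Godement, *Domaines fondamentaux des groupes arithmétiques*, Sém. Bourbaki 257 (1962∕63), §8.
* [MoeglinWaldspurger1995] C. Mœglin, J.-L. Waldspurger, *Spectral Decomposition and Eisenstein Series* (1995), II.1.5.
* [Garrett2018] P. Garrett, *Modern Analysis of Automorphic Forms by Example* (2018), §3.10 (proof of Cor. 3.10.2).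
* [Rogawski1990] J. D. Rogawski, *Automorphic Representations of Unitary Groups in Three Variables*, Ann. of Math. Stud. 123 (1990), §2.2 (p. 13).
-/

set_option autoImplicit false
-- the mandated namespace repeats the single-problem summit's segment (`HodgeConjecture.HodgeConjecture`)
set_option linter.dupNamespace false

noncomputable section

open MeasureTheory MeasureTheory.Measure Set Filter Topology MulAction NumberField IsDedekindDomain
open scoped ENNReal NNReal Pointwise MatrixGroups
open Literature.MeasureTheory.Group
open Literature.NumberTheory.Automorphic Literature.NumberTheory.Automorphic.UnitaryGroup
open Summit.HodgeConjecture.HodgeConjecture.Cruxes.H413.K2E1BorelEisensteinU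
open Summit.HodgeConjecture.HodgeConjecture.Cruxes.H413.K2E1BorelEisensteinGodementU
open Summit.HodgeConjecture.HodgeConjecture.Cruxes.H413.K2E1BorelParabolicReductionU
open Summit.HodgeConjecture.HodgeConjecture.Cruxes.H413.K2E1BorelParabolicIntegralU3 (parabolicIntegral_borel_three_eq)

namespace Summit.HodgeConjecture.HodgeConjecture.Cruxes.H413.K2E1SiegelIntegralExplicit

variable {F E : Type} [Field F] [NumberField F] [Field E] [NumberField E] [Algebra F E] {c : E ≃ₐ[F] E} {N : ℕ}

/-! ## §1–§2 Quantitative E4: `∫⁻_G 𝟙{H ≤ C₀} H^τ β' dμ = C' · ∫⁻_B 𝟙{H ≤ C₀} H^τ w₁ dμ_B = K' · C₀^{τ−2}` -/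

section E4

variable [NeZero N] [MeasurableSpace (quasiSplit F E c N).Adelic] [BorelSpace (quasiSplit F E c N).Adelic]

/-- **E4 = C'·E5 (any `N`, every weight).**  `μ` a Haar measure on `G(𝔸) = U(J_N)(𝔸_F)`, `G(𝔸) = B(𝔸)·K_U` (`hIw`), `μ_B` a Haar measure on `B(𝔸)` and `w₁` a `B(F)_B`-covering weight.
There is ONE constant `C' ∈ (0, ∞)` such that for EVERY exponent `τ`, every `Γ'`-covering weight `β'` on `G(𝔸)` and every cut-off `C₀`:
  `∫⁻_G 𝟙{H ≤ C₀} H^τ β' dμ = C' · ∫⁻_B 𝟙{H ≤ C₀} H^τ w₁ dμ_B`.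
This is the chain of ★ (G2) `siegelIntegral_ne_top_of_parabolicIntegral` read as the equality it is: `∫⁻_G = C ∫⁻_B ∫⁻_{K_U}` (★ `exists_lintegral_eq_mul_lintegral_borel_lintegral_maximalCompact`),
`H(b k) = H(b)` on `K_U` (★ `borelHeight_mul_of_adelicVal_mem`), the `K_U`-average of `β'` is a `B(F)_B`-weight of mass `μ_K(K_U)` (★ `coveringSum_kAverage`) exchanged for `μ_K(K_U)·w₁`
(★ `lintegral_mul_eq_of_coveringSum_eq`); `C' = C · μ_K(K_U)`. [cite: Godement1964, §8] [cite: Garrett2018, §3.10 (proof of Cor. 3.10.2)] [cite: MoeglinWaldspurger1995, II.1.5] -/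
theorem exists_siegelIntegral_eq_mul_parabolicIntegral (μ : Measure (quasiSplit F E c N).Adelic) [μ.IsHaarMeasure]
    (hIw : ∀ g : (quasiSplit F E c N).Adelic, ∃ b ∈ borelAdelic F E c N, ∃ k : (quasiSplit F E c N).Adelic,
      adelicVal F E c N ((StdForm.antidiagonal N).over E) k ∈ standardMaximalCompactGL N E ∧ g = b * k)
    (μB : Measure (borelAdelic F E c N)) [μB.IsHaarMeasure] {w₁ : borelAdelic F E c N → ℝ≥0∞}
    (hw₁ : IsCoveringWeight ↥(((quasiSplit F E c N).arithmeticSubgroup).subgroupOf (borelAdelic F E c N)) w₁) :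
    ∃ C' : ℝ≥0∞, C' ≠ 0 ∧ C' ≠ ∞ ∧ ∀ (τ : ℝ) {β' : (quasiSplit F E c N).Adelic → ℝ≥0∞},
      IsCoveringWeight ↥(borelAdelic F E c N ⊓ (quasiSplit F E c N).arithmeticSubgroup) β' → ∀ C₀ : ℝ≥0,
        ∫⁻ y, {y | borelHeight y ≤ C₀}.indicator (fun y => ENNReal.ofReal ((borelHeight y : ℝ) ^ τ)) y * β' y ∂μ =
          C' * ∫⁻ b, {b : borelAdelic F E c N | borelHeight (b : (quasiSplit F E c N).Adelic) ≤ C₀}.indicator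
            (fun b => ENNReal.ofReal ((borelHeight (b : (quasiSplit F E c N).Adelic) : ℝ) ^ τ)) b * w₁ b ∂μB := by
  classical
  haveI := countable_borelRat (F := F) (E := E) (c := c) (N := N)
  -- the compact group `K_U` and a Haar measure on it
  have hKc : IsCompact (((standardMaximalCompactGL N E).comap (adelicVal F E c N ((StdForm.antidiagonal N).over E)) : Subgroup (quasiSplit F E c N).Adelic) :
      Set (quasiSplit F E c N).Adelic) := isCompact_comap_adelicVal_standardMaximalCompactGL
  haveI : CompactSpace ↥((standardMaximalCompactGL N E).comap (adelicVal F E c N ((StdForm.antidiagonal N).over E)) : Subgroup (quasiSplit F E c N).Adelic) :=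
    isCompact_iff_compactSpace.1 hKc
  haveI : T2Space (quasiSplit F E c N).Adelic := inferInstanceAs (T2Space (adelic F E c N ((StdForm.antidiagonal N).over E)))
  haveI : SecondCountableTopology (quasiSplit F E c N).Adelic := inferInstanceAs (SecondCountableTopology (adelic F E c N ((StdForm.antidiagonal N).over E)))
  haveI : SecondCountableTopology ↥((standardMaximalCompactGL N E).comap (adelicVal F E c N ((StdForm.antidiagonal N).over E)) : Subgroup (quasiSplit F E c N).Adelic) :=
    TopologicalSpace.Subtype.secondCountableTopology _
  haveI : SecondCountableTopology (borelAdelic F E c N) := secondCountableTopology_borelAdelic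
  haveI : LocallyCompactSpace (borelAdelic F E c N) := locallyCompactSpace_borelAdelic
  haveI : Nonempty ↥((standardMaximalCompactGL N E).comap (adelicVal F E c N ((StdForm.antidiagonal N).over E)) : Subgroup (quasiSplit F E c N).Adelic) := ⟨1⟩
  set μK : Measure ↥((standardMaximalCompactGL N E).comap (adelicVal F E c N ((StdForm.antidiagonal N).over E)) : Subgroup (quasiSplit F E c N).Adelic) :=
    Measure.haarMeasure (⟨⟨Set.univ, isCompact_univ⟩, by simp⟩ :
      TopologicalSpace.PositiveCompacts ↥((standardMaximalCompactGL N E).comap (adelicVal F E c N ((StdForm.antidiagonal N).over E)) : Subgroup (quasiSplit F E c N).Adelic)) with hμK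
  have hμKtop : μK Set.univ ≠ ∞ := (IsCompact.measure_lt_top isCompact_univ).ne
  have hμK0 : μK Set.univ ≠ 0 := isOpen_univ.measure_ne_zero μK Set.univ_nonempty
  -- `∫⁻_G = C ∫⁻_B ∫⁻_{K_U}`
  obtain ⟨C, hC0, hCtop, hGBK⟩ := exists_lintegral_eq_mul_lintegral_borel_lintegral_maximalCompact hIw μ μB μK
  refine ⟨C * μK Set.univ, mul_ne_zero hC0 hμK0, ENNReal.mul_ne_top hCtop hμKtop, fun τ β' hβ' C₀ => ?_⟩
  -- the integrand on `G(𝔸)` and on `B(𝔸)`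
  set Fτ : (quasiSplit F E c N).Adelic → ℝ≥0∞ := fun y => {y | borelHeight y ≤ C₀}.indicator (fun y => ENNReal.ofReal ((borelHeight y : ℝ) ^ τ)) y * β' y with hFτ
  have hpow : Measurable fun y : (quasiSplit F E c N).Adelic => ENNReal.ofReal ((borelHeight y : ℝ) ^ τ) :=
    ENNReal.measurable_ofReal.comp ((measurable_borelHeight.coe_nnreal_real).pow_const τ)
  have hFm : Measurable Fτ := (hpow.indicator (isClosed_setOf_borelHeight_le _).measurableSet).mul hβ'.1
  set g : borelAdelic F E c N → ℝ≥0∞ := fun b => {b : borelAdelic F E c N | borelHeight (b : (quasiSplit F E c N).Adelic) ≤ C₀}.indicator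
    (fun b => ENNReal.ofReal ((borelHeight (b : (quasiSplit F E c N).Adelic) : ℝ) ^ τ)) b with hg
  have hHm : Measurable fun b : borelAdelic F E c N => borelHeight (b : (quasiSplit F E c N).Adelic) := measurable_borelHeight.comp measurable_subtype_coe
  have hgm : Measurable g := (ENNReal.measurable_ofReal.comp (hHm.coe_nnreal_real.pow_const τ)).indicator (measurableSet_le hHm measurable_const)
  have hgtop : ∀ b, g b ≠ ∞ := fun b => ne_top_of_le_ne_top ENNReal.ofReal_ne_top (Set.indicator_le_self _ _ b)
  -- on `b k`: `Fτ (b k) = g b * β' (b k)` since `H(b k) = H(b)`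
  have hpt : ∀ (b : borelAdelic F E c N) (k : ↥((standardMaximalCompactGL N E).comap (adelicVal F E c N ((StdForm.antidiagonal N).over E)) : Subgroup (quasiSplit F E c N).Adelic)),
      Fτ ((b : (quasiSplit F E c N).Adelic) * (k : (quasiSplit F E c N).Adelic)) = g b * β' ((b : (quasiSplit F E c N).Adelic) * (k : (quasiSplit F E c N).Adelic)) := by
    intro b k
    have hHbk : borelHeight ((b : (quasiSplit F E c N).Adelic) * (k : (quasiSplit F E c N).Adelic)) = borelHeight (b : (quasiSplit F E c N).Adelic) :=
      borelHeight_mul_of_adelicVal_mem (Subgroup.mem_comap.1 k.2) _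
    simp only [hFτ, hg, Set.indicator_apply, Set.mem_setOf_eq, hHbk]
  -- integrate over `K_U`
  set w : borelAdelic F E c N → ℝ≥0∞ := fun b => ∫⁻ k, β' ((b : (quasiSplit F E c N).Adelic) * (k : (quasiSplit F E c N).Adelic)) ∂μK with hw
  have hKint : ∀ b : borelAdelic F E c N, ∫⁻ k, Fτ ((b : (quasiSplit F E c N).Adelic) * (k : (quasiSplit F E c N).Adelic)) ∂μK = g b * w b := by
    intro b
    simp_rw [hpt b]
    rw [hw, lintegral_const_mul' _ _ (hgtop b)]
  -- `w` is a `B(F)_B`-weight of mass `μ_K(K_U)`; exchange it for `μ_K(K_U) · w₁`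
  have hwm : Measurable w := by
    rw [hw]
    refine Measurable.lintegral_prod_right ?_
    exact hβ'.1.comp ((continuous_subtype_val.comp continuous_fst).mul (continuous_subtype_val.comp continuous_snd)).measurable
  haveI : MeasurableConstSMul ↥(((quasiSplit F E c N).arithmeticSubgroup).subgroupOf (borelAdelic F E c N)) (borelAdelic F E c N) :=
    ⟨fun δ => measurable_const_mul (δ : borelAdelic F E c N)⟩
  haveI : SMulInvariantMeasure ↥(((quasiSplit F E c N).arithmeticSubgroup).subgroupOf (borelAdelic F E c N)) (borelAdelic F E c N) μB :=
    ⟨fun δ s _hs => by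
      rw [show (fun x : borelAdelic F E c N => δ • x) ⁻¹' s = (fun x : borelAdelic F E c N => (δ : borelAdelic F E c N) * x) ⁻¹' s from rfl, measure_preimage_mul]⟩
  have hginv : ∀ (δ : ↥(((quasiSplit F E c N).arithmeticSubgroup).subgroupOf (borelAdelic F E c N))) (b : borelAdelic F E c N), g (δ • b) = g b := by
    intro δ b
    simp only [hg, Set.indicator_apply, Set.mem_setOf_eq, borelHeight_coe_smul_of_borelRat δ b]
  have hwsum : ∀ b : borelAdelic F E c N, coveringSum ↥(((quasiSplit F E c N).arithmeticSubgroup).subgroupOf (borelAdelic F E c N)) w b = μK Set.univ := fun b =>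
    coveringSum_kAverage μK hβ' b
  have hw₁sum : ∀ b : borelAdelic F E c N, coveringSum ↥(((quasiSplit F E c N).arithmeticSubgroup).subgroupOf (borelAdelic F E c N))
      (fun q => μK Set.univ * w₁ q) b = μK Set.univ := fun b => by
    rw [coveringSum_const_mul, hw₁.2 b, mul_one]
  have hexch : ∫⁻ b, g b * w b ∂μB = ∫⁻ b, g b * (μK Set.univ * w₁ b) ∂μB :=
    lintegral_mul_eq_of_coveringSum_eq μB hgm hginv hwm (hw₁.1.const_mul _) hμK0 hμKtop hwsum hw₁sum
  -- assemble
  change ∫⁻ y, Fτ y ∂μ = _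
  rw [hGBK Fτ hFm]
  simp_rw [hKint]
  rw [hexch]
  have hsplit : ∫⁻ b, g b * (μK Set.univ * w₁ b) ∂μB = μK Set.univ * ∫⁻ b, g b * w₁ b ∂μB := by
    simp_rw [← mul_assoc, mul_comm (g _) (μK Set.univ), mul_assoc]
    rw [lintegral_const_mul' _ _ hμKtop]
  rw [hsplit, mul_assoc]

end E4

/-- **QUANTITATIVE E4 FOR `U(J₃)`: `∫⁻_G 𝟙{H ≤ C₀} H^τ β' dμ = K' · C₀^{τ−2}`** (`[E:F] = 2`, `c² = 1`, `c ≠ 1`, Iwasawa `hIw`, `τ > 2`): one constant `K' ∈ (0, ∞)` for every `Γ'`-covering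
weight `β'` and every cut-off `C₀` — §1 at `N = 3` with ★ (G3) `parabolicIntegral_borel_three_eq` (`∫⁻_B 𝟙{H ≤ C₀} H^τ w dμ_B = K·C₀^{τ−2}`). [cite: Godement1964, §8]
[cite: MoeglinWaldspurger1995, II.1.5] [cite: Garrett2018, §3.10 (proof of Cor. 3.10.2)] [cite: Rogawski1990, §2.2 (p. 13)] -/
theorem exists_siegelIntegral_eq_mul_rpow_three [MeasurableSpace (quasiSplit F E c 3).Adelic] [BorelSpace (quasiSplit F E c 3).Adelic]
    (h2 : Module.finrank F E = 2) (hc : c * c = 1) (hc1 : c ≠ 1) (μ : Measure (quasiSplit F E c 3).Adelic) [μ.IsHaarMeasure]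
    (hIw : ∀ g : (quasiSplit F E c 3).Adelic, ∃ b ∈ borelAdelic F E c 3, ∃ k : (quasiSplit F E c 3).Adelic,
      adelicVal F E c 3 ((StdForm.antidiagonal 3).over E) k ∈ standardMaximalCompactGL 3 E ∧ g = b * k)
    {τ : ℝ} (hτ : 2 < τ) :
    ∃ K' : ℝ≥0∞, K' ≠ 0 ∧ K' ≠ ∞ ∧ ∀ {β' : (quasiSplit F E c 3).Adelic → ℝ≥0∞},
      IsCoveringWeight ↥(borelAdelic F E c 3 ⊓ (quasiSplit F E c 3).arithmeticSubgroup) β' → ∀ C₀ : ℝ≥0,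
        ∫⁻ y, {y | borelHeight y ≤ C₀}.indicator (fun y => ENNReal.ofReal ((borelHeight y : ℝ) ^ τ)) y * β' y ∂μ = K' * ENNReal.ofReal ((C₀ : ℝ) ^ (τ - 2)) := by
  haveI : LocallyCompactSpace (borelAdelic F E c 3) := locallyCompactSpace_borelAdelic
  haveI : T2Space (borelAdelic F E c 3) := t2Space_borelAdelic
  set μB : Measure (borelAdelic F E c 3) := Measure.haar with hμB
  obtain ⟨w, K, hw, hK0, hKt, hK⟩ := parabolicIntegral_borel_three_eq h2 hc hc1 μB hτ
  obtain ⟨C', hC'0, hC't, hC'⟩ := exists_siegelIntegral_eq_mul_parabolicIntegral μ hIw μB hw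
  exact ⟨C' * K, mul_ne_zero hC'0 hK0, ENNReal.mul_ne_top hC't hKt, fun hβ' C₀ => by rw [hC' τ hβ' C₀, hK C₀, mul_assoc]⟩


end Summit.HodgeConjecture.HodgeConjecture.Cruxes.H413.K2E1SiegelIntegralExplicit

end
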